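import Summits.Ventures.PercRepro.OneEdgeMonoDel
import Summits.Ventures.PercRepro.ConnD

/-!
# PercRepro — a planted control for `OneEdgeMonoC026`: the a/b–non-mark exclusion is necessary (p1, gen 5)

mine-3's exact witness (`proofs/MINE3-Q3-proof.md` §16 add. 2 (b)): on the simple graph
`g5_0024 = {04, 13, 14, 23, 24, 34}` with marks `a b c = 0 1 2` the class slack DECREASES when the
`a`–non-mark edge `0–4` is added — `CS(G) = 29 − 14 = 15 < 16 = 16 − 0 = CS(G − e)`.  The four counts are
kernel-checked by `decide` through p6's breadth-first connectivity (`mem_reach_iff`).  Hence the hypothesis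
WITHOUT the edge-type restriction is false (`not_oneEdgeMono_without_edge_type`), while the witness edge is of
type a/b–non-mark (`witness5_abNonMark`) and the graph is simple (`witness5_isSimple`): `OneEdgeMonoC026`
asks for exactly the class the census supports.  Parked beside `OneEdgeMono.lean` (not in the landing set).
-/

namespace PercRepro

open Finset

namespace MultiGraph

/-- `OnePair` is decidable when connectivity is. -/
instance instDecidableOnePair {V E : Type*} (G : MultiGraph V E) (ω : Config E) (a b c : V)
    [DecidableRel (G.Conn ω)] : Decidable (G.OnePair ω a b c) := by
  unfold OnePair
  infer_instance

/-- `IsCIso` is decidable when connectivity is. -/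
instance instDecidableIsCIso {V E : Type*} (G : MultiGraph V E) (ω : Config E) (a b c : V)
    [DecidableRel (G.Conn ω)] : Decidable (G.IsCIso ω a b c) := by
  unfold IsCIso
  infer_instance

/-- mine-3's witness `g5_0024 = {04, 13, 14, 23, 24, 34}` on `Fin 5`; edge `0` is `0–4`. -/
def witness5 : MultiGraph (Fin 5) (Fin 6) where
  fst := ![0, 1, 1, 2, 2, 3]
  snd := ![4, 3, 4, 3, 4, 4]

/-- Kernel-cheap connectivity on the witness: p6's reach sets. -/
instance (priority := high) instDecidableRelConnWitness5 (ω : Config (Fin 6)) :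
    DecidableRel (witness5.Conn ω) :=
  fun u v => decidable_of_iff _ (witness5.mem_reach_iff ω u v)

/-- The witness is simple (no loops, no parallel edges). -/
theorem witness5_isSimple : witness5.IsSimple := by
  unfold IsSimple Parallel witness5
  decide

/-- The witness edge `0 = 0–4` is of type a/b–non-mark for the marks `0 1 2`. -/
theorem witness5_abNonMark : witness5.IsABNonMarkEdge 0 1 2 0 := by
  unfold IsABNonMarkEdge witness5
  decide

/-- `#OnePair(G) = 29`. -/
theorem witness5_count_onePair :
    (univ.filter fun ρ : Config (Fin 6) => witness5.OnePair ρ 0 1 2).card = 29 := by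
  decide

/-- `#{a ~ b ∧ c iso in ρᶜ}(G) = 14`. -/
theorem witness5_count_bad :
    (univ.filter fun ρ : Config (Fin 6) => witness5.Conn ρ 0 1 ∧ witness5.IsCIso ρᶜ 0 1 2).card = 14 := by
  decide

/-- `#OnePair(G − e) = 16`. -/
theorem witness5_count_onePair_del :
    (univ.filter fun ρ : Config (Fin 6) => ρ 0 = false ∧ witness5.OnePair ρ 0 1 2).card = 16 := by
  decide

/-- `#{a ~ b ∧ c iso in the antipode}(G − e) = 0`. -/
theorem witness5_count_bad_del :
    (univ.filter fun ρ : Config (Fin 6) => ρ 0 = false ∧ witness5.Conn ρ 0 1 ∧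
      witness5.IsCIso (Function.update ρᶜ 0 false) 0 1 2).card = 0 := by
  decide

/-- **The planted control**: on the witness the class slack decreases when the `a`–non-mark edge is added,
`CS(G) = 15 < 16 = CS(G − e)`. -/
theorem witness5_cs_lt :
    witness5.cubeSumQuad ![0, 1, 2] kernel26 < (witness5.deleteEdge 0).cubeSumQuad ![0, 1, 2] kernel26 := by
  rw [witness5.cubeSumQuad_kernel26_eq, witness5.cubeSumQuad_deleteEdge,
    witness5.cubeSumDel_kernel26_eq]
  have key : ((29 : ℕ) : ℝ) - ((14 : ℕ) : ℝ) < ((16 : ℕ) : ℝ) - ((0 : ℕ) : ℝ) := by norm_num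
  convert key using 3
  · convert witness5_count_onePair
  · convert witness5_count_bad
  · convert witness5_count_onePair_del
  · convert witness5_count_bad_del

end MultiGraph

/-- **The edge-type restriction of `OneEdgeMonoC026` is necessary**: the same statement asked at EVERY edge
of every simple graph with three distinct marks is false (the witness `g5_0024`, edge `0–4`). -/
theorem not_oneEdgeMono_without_edge_type :
    ¬ ∀ {V E : Type} [Fintype V] [Fintype E] [DecidableEq E] (G : MultiGraph V E), G.IsSimple →
      ∀ a b c : V, a ≠ b → a ≠ c → b ≠ c → ∀ e : E,
        (G.deleteEdge e).cubeSumQuad ![a, b, c] kernel26 ≤ G.cubeSumQuad ![a, b, c] kernel26 := by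
  intro h
  have := h MultiGraph.witness5 MultiGraph.witness5_isSimple 0 1 2 (by decide) (by decide) (by decide) 0
  exact absurd this (not_le.2 MultiGraph.witness5_cs_lt)

end PercRepro
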